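import Literature.IUT.HodgeTheaters.PiAvatarLabelAutPM
import HarnessLib

/-!
# KIT-INSTANCE-SPEC P5-binding, LOCAL label slots (I): the interface law `LocalArrowLaw` of a local object `𝒟_v̲ = ℬ(Π_v̲)⁰`
# and the label action `Aut(𝒟_v̲) → Aut(LabCusp^±(𝒟_v̲))` through `{±1}` ([IUTchI] Def 6.1 (ii)(iii), Ex 6.3 (i); one binder
# structure + defs — post-freeze additive D13, not a cone member)

S. Mochizuki, *Inter-universal Teichmüller theory I*, kurims manuscript (May 2020), Def 6.1 (iii) p. 156 l.23 – p. 157 l.24 («it makes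
sense to speak of the set of cusps of `†𝒟_v` … we define a ±-label class of cusps of `†𝒟_v` to be the set of cusps of `†𝒟_v` that lie
over a single cusp of `†𝒟_v^±` … `LabCusp^±(†𝒟_v)` is equipped with a natural `𝔽_l^±`-group structure. This `𝔽_l^±`-group structure
determines a natural surjection `Aut(†𝒟_v) ↠ {±1}` — i.e., by considering the induced automorphism of `LabCusp^±(†𝒟_v)`»), Def 6.1 (ii)
p. 156 (`†𝒟_v^±` «corresponding to `X̲_v`» — UNDERLINED in print, HOME/lit/IUTchI-DEF61-VERBATIM.md certification 2026-08-26),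
Ex 6.3 (i) p. 161 (`φ^{Θell}_{v̲_t}` = `φ^{Θell}_{•,v̲}` post-composed with the poly-action of `t` on `𝒟^{⊚±}`), Rmk 1.1.2 / Cor 1.2
pp. 39 («`X̲→` … completely determined, up to `k`-isomorphism, by the data `(X/k, C̲, ε̲)`»; characteristic nature of coverings)
([IUTchI] Def 6.1 (iii) p.156) [claim: Mochizuki2012, status: disputed] (D-0012 claim key, series status DISPUTED — ONE interface LAW
(a `structure … : Prop` HYPOTHESIS binder in the pattern of abc-iut-L5-t1's `ArrowCoveringClaims` / abc-iut-L5-t4's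
`CuspClassesNormaliserStable`, never asserted) plus definitions and kernel theorems over abc-iut-L5-t2's REAL `InitialThetaData`,
abc-iut-L5-t1's `CuspGalois`; nothing of the series is asserted, no side is taken on [IUTchIII] Cor. 3.12).

## Design (HOME/staging/L5/L5-t4/g4/DESIGN-LocalSlots.md; D1 EMBEDDED, RULINGS #17)
A local object is `ℬ(H)⁰` for a subgroup `H ≤ Π_{X̲_K}` of `Π_{C_F}` (`H = Π_v̲ = Π_{X̲→_K} ∩ augGF⁻¹(G_v̲)` at good `v̲`,
`PiAvatarBinding.locModelObj`; the member `H_v` of the SHAPE-OF-RECORD pair at bad `v̲`, G-L5t4g3-2 (iii)). Its `±`-label classes of cusps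
are the cusps of `X̲_v̲`, i.e. `Cusp(X̲_K)` (constant type, charts `{±gChart₀}` based at `ε⁰`). The binder `LocalArrowLaw H` says:
* `le_PiXund` — `H ≤ Π_{X̲_K}` (side condition, a theorem at every instance);
* (L1) `mem_normalizer_of_conj_le` — «every morphism `𝒟_v̲ → 𝒟^{⊚±}` of the ambient is `φ^{Θell}_{•,v̲}` followed by an automorphism of
  `𝒟^{⊚±}`»: an element `d` with `d⁻¹ H d ≤ Π_{X̲_K}` normalises `Π_{X̲_K}` (Ex 6.3 (i); Rmk 1.1.2 / Cor 1.2 + [AbsTopIII] Thm 1.9). Hence every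
  automorphism of `𝒟_v̲` is induced by one of `𝒟^{⊚±}` (`normalizer_le`), and acts on the labels through abc-iut-L5-t4's `actF`;
* (L2) `sign` — «`Aut(†𝒟_v) ↠ {±1}` … by considering the induced automorphism of [the `𝔽_l^±`-GROUP] `LabCusp^±(†𝒟_v)`»: that action reads
  `z ↦ ±z` in the chart based at the zero cusp (Def 6.1 (iii) p.157 l.9).
Built over it: `locActF` / **`locLabAut Λ : Aut(ℬ(H)⁰) →* Perm Cusp(X̲_K)`** (the kit slot `labMap` at the model, `= (actF n)⁻¹` on
`xH ↦ xnH`), `exists_sign_locLabAut`, **`locLabAut_trans_mem_charts`** (kit law `labMap_charts` at the model), **`locLabAut_ne_one_of_not_mem`**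
(an element of `Π_{C̲_K} ∖ Π_{X̲_K}` normalising `H` — the `±`-involution of abc-iut-L5-t4 `exists_localInvolution` / abc-iut-L5-t13
`exists_negCompat_good_labels` — is NEGATIVE: kit law `exists_negative`), `locLabAut_eq_gLabAutModel` (local action = global action).
No instance, no notation; typed ≠ proved elsewhere; binder ≠ fact.
-/

noncomputable section

namespace Literature.IUT.HodgeTheaters

open CategoryTheory

universe u v w

section LocalLabels

variable {F : Type u} {K : Type v} {Fbar : Type w} [Field F] [NumberField F] [Field K] [NumberField K]
  [Algebra F K] [Field Fbar] [Algebra F Fbar] [Algebra K Fbar]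
  {E : WeierstrassCurve F} [E.IsElliptic] {l : ℕ} {Pb : BadPlacePredicates K}
  (D : InitialThetaData F K Fbar E l Pb) (CG : D.geom.pe.CuspGalois) (hS : D.CuspClassesNormaliserStable)

namespace InitialThetaData

variable [Fact l.Prime]

/-! ### The interface law of a local object -/

/-- **The LOCAL ARROW LAW of a local object `𝒟_v̲ = ℬ(H)⁰`, `H ≤ Π_{X̲_K}`** ([IUTchI] Def 6.1 (ii)(iii), Ex 6.3 (i); a HYPOTHESIS
binder for consumers — interface-claims pattern, never asserted): (L1) an element `d ∈ Π_{C_F}` conjugating `H` into `Π_{X̲_K}`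
(i.e. a morphism `ℬ(H)⁰ → ℬ(Π_{X̲_K})⁰ = 𝒟^{⊚±}` of the ambient) normalises `Π_{X̲_K}` — «`φ^{Θell}_{v̲_t}` … obtained by post-composing
`φ^{Θell}_0` with the poly-action of `t` on `𝒟^{⊚±}`» (Ex 6.3 (i) p.161), every automorphism of `X̲→_v̲` being determined by the data
`(X, C̲, ε̲)` (Rmk 1.1.2, Cor 1.2); (L2) automorphisms of `𝒟_v̲` act on the `𝔽_l^±`-group `LabCusp^±(𝒟_v̲) = Cusp(X̲_v̲)` by `±1` in the
chart based at the zero cusp — «`Aut(†𝒟_v) ↠ {±1}` … by considering the induced automorphism of `LabCusp^±(†𝒟_v)`» (Def 6.1 (iii)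
p.157). ([IUTchI] Def 6.1 (iii) p.157) [claim: Mochizuki2012, status: disputed] -/
structure LocalArrowLaw (H : Subgroup D.PiC) : Prop where
  /-- `H ≤ Π_{X̲_K}` (the local group lies in the global one: `Π_{X̲→_K} ∩ augGF⁻¹(G_v̲) ≤ Π_{X̲_K}`) -/
  le_PiXund : H ≤ D.PiXund
  /-- (L1) `d⁻¹ H d ≤ Π_{X̲_K} ⇒ d ∈ N(Π_{X̲_K})`: morphisms `𝒟_v̲ → 𝒟^{⊚±}` are `Aut(𝒟^{⊚±})`-translates of `φ^{Θell}_{•,v̲}` -/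
  mem_normalizer_of_conj_le : ∀ d : D.PiC, (∀ x ∈ H, d⁻¹ * x * d ∈ D.PiXund) →
    d ∈ Subgroup.normalizer ((D.PiXund : Subgroup D.PiC) : Set D.PiC)
  /-- (L2) an automorphism of `𝒟_v̲` (an element normalising `H`, hence `Π_{X̲_K}`) acts on the labels by `z ↦ ±z` in the chart at `ε⁰` -/
  sign : ∀ n : D.PiC, n ∈ Subgroup.normalizer ((H : Subgroup D.PiC) : Set D.PiC) →
    ∀ hn : n ∈ Subgroup.normalizer ((D.PiXund : Subgroup D.PiC) : Set D.PiC),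
      ∃ ε : ℤˣ, ∀ x, D.gChart₀Model CG (D.actF CG hS ⟨n, hn⟩ x) = ε • D.gChart₀Model CG x

namespace LocalArrowLaw

variable {D CG hS} {H : Subgroup D.PiC} (Λ : D.LocalArrowLaw CG hS H)
include Λ

/-- **Every automorphism of `𝒟_v̲` is induced by one of `𝒟^{⊚±}`**: `N(H) ≤ N(Π_{X̲_K})` (from (L1) with `d := n`, as `n⁻¹ H n = H ≤ Π_{X̲_K}`).
([IUTchI] Def 6.1 (iii) p.157) [claim: Mochizuki2012, status: disputed] -/
theorem normalizer_le : Subgroup.normalizer ((H : Subgroup D.PiC) : Set D.PiC) ≤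
    Subgroup.normalizer ((D.PiXund : Subgroup D.PiC) : Set D.PiC) := by
  intro n hn
  refine Λ.mem_normalizer_of_conj_le n fun x hx => Λ.le_PiXund ?_
  have h := (Subgroup.mem_normalizer_iff.mp (Subgroup.inv_mem _ hn) x).mp hx
  simpa using h

/-- The inclusion `N(H) ↪ N(Π_{X̲_K})`. ([IUTchI] Def 6.1 (iii) p.157) [claim: Mochizuki2012, status: disputed] -/
def normalizerIncl : ↥(Subgroup.normalizer ((H : Subgroup D.PiC) : Set D.PiC)) →*
    ↥(Subgroup.normalizer ((D.PiXund : Subgroup D.PiC) : Set D.PiC)) :=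
  Subgroup.inclusion Λ.normalizer_le

/-- The inclusion is the identity on elements. ([IUTchI] Def 6.1 (iii) p.157) [claim: Mochizuki2012, status: disputed] -/
@[simp] theorem coe_normalizerIncl (n : ↥(Subgroup.normalizer ((H : Subgroup D.PiC) : Set D.PiC))) :
    ((Λ.normalizerIncl n : ↥(Subgroup.normalizer ((D.PiXund : Subgroup D.PiC) : Set D.PiC))) : D.PiC) = n := rfl

/-! ### The label action of `N(H)` and of `Aut(ℬ(H)⁰)` -/

/-- The action of `N(H)` on `LabCusp^±(𝒟_v̲) = Cusp(X̲_K)`: the global `actF` restricted along `N(H) ≤ N(Π_{X̲_K})`.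
([IUTchI] Def 6.1 (iii) p.157) [claim: Mochizuki2012, status: disputed] -/
def locActF : ↥(Subgroup.normalizer ((H : Subgroup D.PiC) : Set D.PiC)) →* Equiv.Perm D.geom.pe.Cusp :=
  (D.actF CG hS).comp Λ.normalizerIncl

/-- `locActF n = actF n`. ([IUTchI] Def 6.1 (iii) p.157) [claim: Mochizuki2012, status: disputed] -/
theorem locActF_apply (n : ↥(Subgroup.normalizer ((H : Subgroup D.PiC) : Set D.PiC))) :
    Λ.locActF n = D.actF CG hS ⟨n, Λ.normalizer_le n.2⟩ := rfl

/-- Elements of `H` (⊆ `Π_{X̲_K}`) act trivially, so the action descends to `Aut(ℬ(H)⁰) = N(H)/H`.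
([IUTchI] Def 6.1 (iii) p.157) [claim: Mochizuki2012, status: disputed] -/
theorem subgroupOf_le_ker_locActF :
    H.subgroupOf (Subgroup.normalizer ((H : Subgroup D.PiC) : Set D.PiC)) ≤ Λ.locActF.ker := by
  intro n hn
  rw [MonoidHom.mem_ker, locActF_apply]
  exact D.actF_eq_one_of_mem_PiXund CG hS _ (Λ.le_PiXund (Subgroup.mem_subgroupOf.mp hn))

/-- **Kit slot `labMap` at the local model `ℬ(H)⁰`, on automorphisms: `Aut(𝒟_v̲) → Aut(LabCusp^±(𝒟_v̲))`** — `autEquiv⁻¹` followed by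
`locActF` descended modulo `H` (same construction and convention as the global `gLabAutModel`).
([IUTchI] Def 6.1 (iii) p.157) [claim: Mochizuki2012, status: disputed] -/
def locLabAut : Aut (OrbitCat.of H) →* Equiv.Perm D.geom.pe.Cusp :=
  (QuotientGroup.lift _ Λ.locActF Λ.subgroupOf_le_ker_locActF).comp (OrbitCat.autEquiv H).symm.toMonoidHom

/-- **Convention**: on `xH ↦ xmH` the label action is `(actF m)⁻¹`. ([IUTchI] Def 6.1 (iii) p.157) [claim: Mochizuki2012, status: disputed] -/
theorem locLabAut_autOfNormalizer (m : D.PiC) (hm : m ∈ Subgroup.normalizer ((H : Subgroup D.PiC) : Set D.PiC)) :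
    Λ.locLabAut (OrbitCat.autOfNormalizer m hm) = (D.actF CG hS ⟨m, Λ.normalizer_le hm⟩)⁻¹ := by
  have h1 : (OrbitCat.autOfNormalizer m hm : Aut (OrbitCat.of H)) =
      OrbitCat.autEquiv H (QuotientGroup.mk ⟨m⁻¹, Subgroup.inv_mem _ hm⟩) := by
    rw [OrbitCat.autEquiv_mk, OrbitCat.autOfNormalizerHom_apply, OrbitCat.autOfNormalizer_eq_iff]
    simp
  have h2 : (OrbitCat.autEquiv H).symm (OrbitCat.autOfNormalizer m hm) = QuotientGroup.mk ⟨m⁻¹, Subgroup.inv_mem _ hm⟩ := by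
    rw [h1, MulEquiv.symm_apply_apply]
  have h3 : (⟨m⁻¹, Subgroup.inv_mem _ hm⟩ : ↥(Subgroup.normalizer ((H : Subgroup D.PiC) : Set D.PiC))) = ⟨m, hm⟩⁻¹ := rfl
  change QuotientGroup.lift _ Λ.locActF Λ.subgroupOf_le_ker_locActF ((OrbitCat.autEquiv H).symm (OrbitCat.autOfNormalizer m hm)) = _
  rw [h2, QuotientGroup.lift_mk, h3, map_inv]
  rfl

/-- **Local action = global action**: if `m` normalises both `H` and `Π_{X̲_K}`, the label action of the automorphism of `𝒟_v̲` it induces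
equals that of the automorphism of `𝒟^{⊚±}` it induces (`gLabAutModel`). ([IUTchI] Ex 6.3 (i) p.161) [claim: Mochizuki2012, status: disputed] -/
theorem locLabAut_eq_gLabAutModel (m : D.PiC) (hm : m ∈ Subgroup.normalizer ((H : Subgroup D.PiC) : Set D.PiC)) :
    Λ.locLabAut (OrbitCat.autOfNormalizer m hm) =
      D.gLabAutModel CG hS (OrbitCat.autOfNormalizer m (Λ.normalizer_le hm)) := by
  rw [locLabAut_autOfNormalizer, D.gLabAutModel_autOfNormalizer CG hS]

/-! ### (L2) read on the action: signs, charts, negativity -/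

/-- **Every automorphism of `𝒟_v̲` acts on the labels by `±1`** in the chart based at `ε⁰` ((L2); the inverse of `z ↦ εz` is `z ↦ εz`).
([IUTchI] Def 6.1 (iii) p.157) [claim: Mochizuki2012, status: disputed] -/
theorem exists_sign_locLabAut (α : Aut (OrbitCat.of H)) :
    ∃ ε : ℤˣ, ∀ x, D.gChart₀Model CG (Λ.locLabAut α x) = ε • D.gChart₀Model CG x := by
  obtain ⟨m, hm, rfl⟩ := OrbitCat.exists_eq_autOfNormalizer α
  obtain ⟨ε, hε⟩ := Λ.sign m hm (Λ.normalizer_le hm)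
  refine ⟨ε, fun x => ?_⟩
  rw [locLabAut_autOfNormalizer]
  -- `y := (actF m)⁻¹ x` satisfies `gChart₀ x = ε • gChart₀ y`, whence `gChart₀ y = ε • gChart₀ x` (`ε² = 1`)
  have h := hε ((D.actF CG hS ⟨m, Λ.normalizer_le hm⟩)⁻¹ x)
  rw [← Equiv.Perm.mul_apply, mul_inv_cancel, Equiv.Perm.one_apply] at h
  rw [h, smul_smul, Int.units_mul_self, one_smul]

/-- The chart conjugate of the label action of an automorphism is a chart of the `𝔽_l^±`-GROUP of labels.
([IUTchI] Def 6.1 (iii) p.157) [claim: Mochizuki2012, status: disputed] -/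
theorem locLabAut_trans_gChart₀_mem_charts (α : Aut (OrbitCat.of H)) :
    (Λ.locLabAut α).trans (D.gChart₀Model CG) ∈ (D.gLabPMModel CG).charts := by
  obtain ⟨ε, hε⟩ := Λ.exists_sign_locLabAut α
  refine ⟨ε, ?_⟩
  ext x
  change ε • D.gChart₀Model CG x = D.gChart₀Model CG (Λ.locLabAut α x)
  rw [hε]

/-- **Kit law `labMap_charts` at the local model**: pulling back a chart of `LabCusp^±(𝒟_v̲)` along the label action of an automorphism
gives a chart. ([IUTchI] Def 6.1 (iii) p.157) [claim: Mochizuki2012, status: disputed] -/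
theorem locLabAut_trans_mem_charts (α : Aut (OrbitCat.of H)) {e : D.geom.pe.Cusp ≃ ZMod l}
    (he : e ∈ (D.gLabPMModel CG).charts) : (Λ.locLabAut α).trans e ∈ (D.gLabPMModel CG).charts := by
  obtain ⟨η, rfl⟩ := he
  change (Λ.locLabAut α).trans ((D.gChart₀Model CG).trans (signPerm l η)) ∈ _
  rw [← Equiv.trans_assoc]
  exact (D.gLabPMModel CG).trans_signPerm_mem (Λ.locLabAut_trans_gChart₀_mem_charts α) η

/-- **Negativity of the `±`-involution (kit law `exists_negative`)**: an element `c ∈ Π_{C̲_K} ∖ Π_{X̲_K}` normalising `H` induces an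
automorphism of `𝒟_v̲` acting NON-TRIVIALLY on the labels (it reads `z ↦ −z`, (K2), and `l ≠ 2`).
([IUTchI] Def 6.1 (iii) p.157) [claim: Mochizuki2012, status: disputed] -/
theorem locLabAut_ne_one_of_not_mem {c : D.PiC} (hcH : c ∈ Subgroup.normalizer ((H : Subgroup D.PiC) : Set D.PiC))
    (hc : c ∈ D.PiCund) (hcX : c ∉ D.PiXund) : Λ.locLabAut (OrbitCat.autOfNormalizer c hcH) ≠ 1 := by
  intro h1
  -- the action of `c` reads `−z`; evaluate at `ε′ ↦ 1`
  have hc' : D.geom.embK (D.preimOfPiCund c hc) ∈ Subgroup.normalizer ((D.PiXund : Subgroup D.PiC) : Set D.PiC) := by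
    rw [D.embK_preimOfPiCund c hc]
    exact Λ.normalizer_le hcH
  have hact : D.actF CG hS ⟨c, Λ.normalizer_le hcH⟩ = D.gLabAutOfPiCund CG c hc := by
    have heq : (⟨c, Λ.normalizer_le hcH⟩ : ↥(Subgroup.normalizer ((D.PiXund : Subgroup D.PiC) : Set D.PiC))) =
        ⟨D.geom.embK (D.preimOfPiCund c hc), hc'⟩ := Subtype.ext (D.embK_preimOfPiCund c hc).symm
    rw [heq, D.actF_embK CG hS, gLabAutOfPiCund]
  rw [Λ.locLabAut_autOfNormalizer, inv_eq_one, hact] at h1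
  have key := D.gChart₀Model_gLabAut_of_not_mem_PiXund CG c hc hcX D.geom.pe.ε1
  rw [h1, Equiv.Perm.one_apply, D.gChart₀Model_ε1 CG] at key
  haveI : Fact (2 < l) := ⟨by have := D.five_le_l; omega⟩
  exact ZMod.neg_one_ne_one key.symm

/-- Kit law `exists_negative` at the local model, from an element of `Π_{C̲_K} ∖ Π_{X̲_K}` normalising `H` (supplied at good `v̲` by
abc-iut-L5-t4's `exists_localInvolution` / abc-iut-L5-t13's `exists_negCompat_good_labels`, at bad `v̲` by the SHAPE-OF-RECORD pair).
([IUTchI] Def 6.1 (iii) p.157) [claim: Mochizuki2012, status: disputed] -/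
theorem exists_locLabAut_ne_one (h : ∃ c ∈ Subgroup.normalizer ((H : Subgroup D.PiC) : Set D.PiC), c ∈ D.PiCund ∧ c ∉ D.PiXund) :
    ∃ α : Aut (OrbitCat.of H), Λ.locLabAut α ≠ 1 := by
  obtain ⟨c, hcH, hc, hcX⟩ := h
  exact ⟨OrbitCat.autOfNormalizer c hcH, Λ.locLabAut_ne_one_of_not_mem hcH hc hcX⟩

end LocalArrowLaw

end InitialThetaData

end LocalLabels

end Literature.IUT.HodgeTheaters
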